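import Mathlib
import Summits.PneNP.PneNP.Theorems.KrwChromaticSteeringStrongCompositionLradDefs

/-!
# Route KrwChromaticSteering, crux `StrongComposition` (stmt-PneNP-18538) — objects of the line `lrb-gluing`:
# the guarded support notion `SubspaceHard` and the support statement S0⁺ `jointSubspaceHard_exists`

Definitions file for the crux line `lrb-gluing` (skeleton
`Summits/PneNP/PneNP/Cruxes/StrongComposition/Lines/lrb_gluing.lean`, planner pnp-ideate-p4 g20, crux-write commit
a8aec83bbc15; its rung `StrongCompositionLRB` is the crux C1 `Summit.PneNP.PneNP.Theses.KrwChromaticSteering.StrongComposition`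
VERBATIM, restricted to protocols of the disciplined class LRB = LRAD + single-row tests on algebraic rows).  Crux workfiles are
not importable modules, so the line's objects are carried VERBATIM under `Theorems/`.  The vocabulary LRB shares with the line
`lrad-gluing` — `SolvesRect`, `Hard`, `rowParity`, `AffGeneric`, … — is IMPORTED from `…Theorems.KrwLrad`
(`KrwChromaticSteeringStrongCompositionLradDefs.lean`) and not re-declared; this file adds the two objects the support stub
`stub_jointSubspaceHard` is stated in (declaration bodies byte-identical to
`…Cruxes.StrongComposition.LrbGluing.SubspaceHard` / `.jointSubspaceHard_exists`, themselves verbatim `P4g20X.*` of the sketch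
`Cruxes/StrongComposition/NextRungP4g20.lean`):

* `SubspaceHard g q` — on every SATISFIABLE system `F` of `λ ≤ q` parity equations, the Karchmer–Wigderson game of `g`
  restricted to the solution set of `F` (answers are ambient coordinates) needs protocol depth `≥ q − λ`.  The satisfiability
  guard is the g20 repair recorded by referee SCORE 369 (an unsatisfiable `F` constrains nothing); `λ = 0` gives KW-depth
  `≥ q`, and `q ≥ 1` forces `g` non-constant.
* `jointSubspaceHard_exists` — S0⁺: for some constant `c` and every `n` with `c (log₂ n + 1) + 1 ≤ n`, ONE
  `g : {0,1}^n → {0,1}` that is `c (log₂ n + 1)`-affine-generic AND subspace-hard with budget `n − c (log₂ n + 1) − 1`.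

The PROOF of S0⁺ (`stub_jointSubspaceHard`: Riordan–Shannon counting through the easy direction of Karchmer–Wigderson, one union
bound over subspaces and small circuits) is the sibling file `KrwChromaticSteeringStrongCompositionLrbJointSubspaceHard.lean`.  No
theorem is proved here.  Honest framing: the rung LRB is a CLASS-RESTRICTED form of Meir's open problem (strong composition with
`γ = 1`, [Meir2023] = O. Meir, *Toward better depth lower bounds: a KRW-like theorem for strong composition*, FOCS 2023 /
arXiv:2306.00615); C1 itself stays open and nothing in this file bears on P vs NP.
-/

set_option linter.dupNamespace false -- `Summit.PneNP.PneNP.…`: summit = sub-problem name (D-0017 single-conjunct layout)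
set_option autoImplicit false

namespace Summit.PneNP.PneNP.Theorems.KrwLrb

open Literature.Computability.Complexity
open Summit.PneNP.PneNP.Theorems.KrwLrad

variable {n : ℕ}

/-- **Subspace-hardness with budget `q`** (support notion S0⁺ of the line `lrb-gluing`, GUARDED form): for every satisfiable
system `F` of at most `q` parity equations `⨁_{j ∈ S} x_j = b` on `{0,1}^n`, every protocol for the Karchmer–Wigderson rectangle
`(Sol F ∩ g⁻¹ 1) × (Sol F ∩ g⁻¹ 0)` has depth `≥ q − |F|`.  VERBATIM the skeleton's `LrbGluing.SubspaceHard` (over the imported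
`KrwLrad.rowParity`, `KrwLrad.Hard`); KW relations of rectangles as in Meir 2023, §2.3. -/
def SubspaceHard (g : (Fin n → Bool) → Bool) (q : ℕ) : Prop :=
  ∀ F : List (Finset (Fin n) × Bool), F.length ≤ q → (∃ x, ∀ e ∈ F, rowParity e.1 x = e.2) →
    Hard {x | (∀ e ∈ F, rowParity e.1 x = e.2) ∧ g x = true}
         {x | (∀ e ∈ F, rowParity e.1 x = e.2) ∧ g x = false} (q - F.length)

/-- **S0⁺, the support statement of the line `lrb-gluing`** (the registered signature of `stub_jointSubspaceHard`): there is
a constant `c` such that for every `n` with `c (log₂ n + 1) + 1 ≤ n` some `g : {0,1}^n → {0,1}` is BOTH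
`c (log₂ n + 1)`-affine-generic (`KrwLrad.AffGeneric`) AND subspace-hard with budget `n − c (log₂ n + 1) − 1`.  VERBATIM the
skeleton's `LrbGluing.jointSubspaceHard_exists`.  Proved (with `c = 3`) in
`KrwChromaticSteeringStrongCompositionLrbJointSubspaceHard.lean`. -/
def jointSubspaceHard_exists : Prop :=
  ∃ c : ℕ, ∀ n : ℕ, c * (Nat.log 2 n + 1) + 1 ≤ n →
    ∃ g : (Fin n → Bool) → Bool,
      AffGeneric g (c * (Nat.log 2 n + 1)) ∧ SubspaceHard g (n - c * (Nat.log 2 n + 1) - 1)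

end Summit.PneNP.PneNP.Theorems.KrwLrb
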